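import Summits.KontsevichZagierPeriods.KontsevichZagierPeriods.Theorems.UnfoldedStokesStokesGenerationStubIntervalTransport
import Literature.NumberTheory.Transcendental.SemialgebraicLineDeriv
import Mathlib.Analysis.SpecialFunctions.Sqrt
import Mathlib.Analysis.Calculus.MeanValue

/-!
# `StokesGeneration` (stmt-KontsevichZagierPeriods-3586) — line `fibrewise_stokes`, stub `stub_isogenyTwoRelator`

Registered rung stub I1 (rung 23, the isogeny layer of genus one; wave 5, lead c6) of the line
`fibrewise_stokes` of the crux `StokesGeneration` (route UnfoldedStokes): **the `2`-isogeny relator is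
fibrewise-Stokes decomposable.** Let `E : y² = x(x² + ax + b)` (real algebraic `a`, `b`) and let
`E′ : Y² = X(X² − 2aX + a² − 4b)` be its `2`-isogenous curve; the `2`-isogeny with kernel `(0,0)` is
`(x, y) ↦ (ψ(x), y(x² − b)/x²)`, `ψ(x) = x + a + b/x = y²/x²`, and `ψ^*(dX/Y) = dx/y` where `x² > b`. For an
arc `x ∈ [α, β]` (algebraic ends) with `x(x² + ax + b) > 0` and `x² > b` there, the cube-normalised
difference `∫_α^β dx/y − ∫_{ψ α}^{ψ β} dX/Y` of the two positive branches, i.e. the integrand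
`s ↦ (β − α)/y(α + (β − α)s) − (ψβ − ψα)/Y(ψα + (ψβ − ψα)s)` on `[0,1]`, is fibrewise-Stokes decomposable
(`FibStokesDecomposable 1`, `Theorems/UnfoldedStokesDefs.lean`).

Proof. This is Kontsevich–Zagier's rule (2) between the two intervals `[α, β]` and `[ψ α, ψ β]`
(`stub_intervalTransport`) for the change of variables `φ = ψ`, `φ′ = (x² − b)/x²`, `k₁ = 1/y`, `k₂ = 1/Y`.
The image point lies on `E′`: the polynomial identity
`U(U² − 2aU + a² − 4b) = x(x² + ax + b)·((x² − b)/x²)²` for `U = ψ(x)` (`isoTwo_radicand_map`; indeed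
`U² − 2aU + a² − 4b = (x − b/x)²` and `U = x(x² + ax + b)/x²`), whence, taking positive square roots,
`Y(ψ x) = y(x)·(x² − b)/x²` and the rule-(2) relation `1/y = (1/Y ∘ ψ)·ψ′`. `ψ` is strictly increasing
(`ψ′ = (x² − b)/x² > 0`, `strictMonoOn_of_deriv_pos`), hence maps `(α, β)` into `(ψ α, ψ β)`, and the
radicand of `Y` is positive on `[ψ α, ψ β]` (every point there is some `ψ x`, `intermediate_value_Icc`).
The data `1/y`, `1/Y`, `(1/Y)′ = −Y′/Y²`, `ψ`, `ψ′` are `ℚ`-semialgebraic (polynomials with algebraic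
coefficients, `√`, quotients: Bochnak–Coste–Roy Prop. 2.2.6) and continuous on the closed intervals.

References: J. H. Silverman, *The Arithmetic of Elliptic Curves* (2nd ed., 2009), III.4.5 (the
`2`-isogeny) and III.5.1 (invariant differential); M. Kontsevich, D. Zagier, *Periods* (2001), §1.2 rule (2);
J. Bochnak, M. Coste, M.-F. Roy, *Real Algebraic Geometry* (1998), §2.1 and Prop. 2.2.6.
-/

noncomputable section

-- `Summit.KontsevichZagierPeriods.KontsevichZagierPeriods.…` is the tree's mandated layout (single-conjunct summit).
set_option linter.dupNamespace false

namespace Summit.KontsevichZagierPeriods.KontsevichZagierPeriods.Cruxes.StokesGeneration.FibrewiseStokes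

open MeasureTheory Set
open Literature.NumberTheory.Transcendental
open Literature.NumberTheory.Transcendental.KZ
open Literature.ModelTheory.ExponentialFields (IsSemialgebraic)

/-- **The `2`-isogeny lands on the isogenous curve.** For `U = ψ(u) = u + a + b/u` (`u ≠ 0`),
`U(U² − 2aU + a² − 4b) = u(u² + au + b)·((u² − b)/u²)²`: indeed `U² − 2aU + a² − 4b = (U − a)² − 4b
= (u − b/u)²` and `U = u(u² + au + b)/u²`. [cite: SilvermanAEC2009, III.4.5] -/
private theorem isoTwo_radicand_map {a b u : ℝ} (hu : u ≠ 0) :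
    (u + a + b / u) * ((u + a + b / u) ^ 2 - 2 * a * (u + a + b / u) + (a ^ 2 - 4 * b)) =
      u * (u ^ 2 + a * u + b) * ((u ^ 2 - b) / u ^ 2) ^ 2 := by
  field_simp
  ring

/-- The closed slab `{z ∈ ℝ¹ | lo ≤ z 0 ≤ hi}` with real algebraic ends is `ℚ`-semialgebraic.
[cite: BochnakCosteRoy1998, §2.1] -/
private theorem isoTwo_isSemialgebraic_slab {lo hi : ℝ} (hlo : IsAlgebraic ℚ lo)
    (hhi : IsAlgebraic ℚ hi) : IsSemialgebraic ℚ {z : Fin 1 → ℝ | z 0 ∈ Set.Icc lo hi} := by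
  have h : {z : Fin 1 → ℝ | z 0 ∈ Set.Icc lo hi} =
      {z : Fin 1 → ℝ | z 0 < lo}ᶜ ∩ {z : Fin 1 → ℝ | hi < z 0}ᶜ := by
    ext z
    simp [not_lt]
  rw [h]
  exact (isSemialgebraic_setOf_apply_lt_const hlo 0).compl.inter
    (isSemialgebraic_setOf_const_lt_apply hhi 0).compl

/-- **Registered stub `stub_isogenyTwoRelator` (rung 23, I1): the `2`-isogeny relator is fibrewise-Stokes
decomposable.** On `E : y² = x(x² + ax + b)` (real algebraic data), for the positive branch over
`[α, β]` (radicand positive, `x² > b` there) and the `2`-isogeny `ψ(x) = x + a + b/x` onto the positive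
branch of `E′ : Y² = X(X² − 2aX + a² − 4b)`, the normalised integrand of
`∫_α^β dx/y − ∫_{ψ α}^{ψ β} dX/Y` is `FibStokesDecomposable 1`: rule (2) between two intervals
(`stub_intervalTransport`) along `φ = ψ`, `φ′ = (x² − b)/x²`, with `k₁ = 1/y`, `k₂ = 1/Y`, the jacobian
identity being `Y(ψ x) = y(x)(x² − b)/x²`. [cite: KontsevichZagier2001, §1.2 rule (2)] -/
theorem stub_isogenyTwoRelator (a b α β : ℝ) (ha : IsAlgebraic ℚ a) (hb : IsAlgebraic ℚ b)
    (hα : IsAlgebraic ℚ α) (hβ : IsAlgebraic ℚ β) (hαβ : α < β)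
    (hf : ∀ u ∈ Set.Icc α β, 0 < u * (u ^ 2 + a * u + b)) (hmono : ∀ u ∈ Set.Icc α β, b < u ^ 2)
    (y Y ψ : ℝ → ℝ) (hy : y = fun u => Real.sqrt (u * (u ^ 2 + a * u + b)))
    (hY : Y = fun U => Real.sqrt (U * (U ^ 2 - 2 * a * U + (a ^ 2 - 4 * b))))
    (hψ : ψ = fun u => u + a + b / u) :
    FibStokesDecomposable 1 (fun s => (β - α) / y (α + (β - α) * s 0) -
      (ψ β - ψ α) / Y (ψ α + (ψ β - ψ α) * s 0)) := by
  -- the two radicands `R` (on `E`) and `P` (on `E′`), and `P′`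
  obtain ⟨R, hRdef⟩ : ∃ R : ℝ → ℝ, R = fun u => u * (u ^ 2 + a * u + b) := ⟨_, rfl⟩
  obtain ⟨P, hPdef⟩ : ∃ P : ℝ → ℝ, P = fun U => U * (U ^ 2 - 2 * a * U + (a ^ 2 - 4 * b)) := ⟨_, rfl⟩
  obtain ⟨P', hP'def⟩ : ∃ P' : ℝ → ℝ, P' = fun U => 3 * U ^ 2 - 4 * a * U + (a ^ 2 - 4 * b) :=
    ⟨_, rfl⟩
  have hRu : ∀ u, R u = u * (u ^ 2 + a * u + b) := fun u => by rw [hRdef]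
  have hPu : ∀ U, P U = U * (U ^ 2 - 2 * a * U + (a ^ 2 - 4 * b)) := fun U => by rw [hPdef]
  have hP'u : ∀ U, P' U = 3 * U ^ 2 - 4 * a * U + (a ^ 2 - 4 * b) := fun U => by rw [hP'def]
  have hyu : ∀ u, y u = √(R u) := fun u => by rw [hy, hRu]
  have hYu : ∀ U, Y U = √(P U) := fun U => by rw [hY, hPu]
  have hψu : ∀ u, ψ u = u + a + b / u := fun u => by rw [hψ]
  have hyf : y = fun u => √(R u) := funext hyu
  have hYf : Y = fun U => √(P U) := funext hYu
  -- positivity on the source arc: `R > 0`, `u ≠ 0`, `ψ′ = (u² − b)/u² > 0`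
  have hR0 : ∀ u ∈ Icc α β, 0 < R u := fun u hu => by rw [hRu]; exact hf u hu
  have hu0 : ∀ u ∈ Icc α β, u ≠ 0 := by
    intro u hu h
    have h0 := hf u hu
    rw [h, zero_mul] at h0
    exact lt_irrefl 0 h0
  have hc0 : ∀ u ∈ Icc α β, 0 < (u ^ 2 - b) / u ^ 2 := fun u hu =>
    div_pos (sub_pos.2 (hmono u hu)) (sq_pos_of_ne_zero (hu0 u hu))
  -- the isogeny lands on `E′`: `P (ψ u) = R u · ((u² − b)/u²)²`, so `Y (ψ u) = y u · (u² − b)/u²`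
  have hPψ : ∀ u ∈ Icc α β, P (ψ u) = R u * ((u ^ 2 - b) / u ^ 2) ^ 2 := fun u hu => by
    rw [hPu, hψu, hRu]
    exact isoTwo_radicand_map (hu0 u hu)
  have hYψ : ∀ u ∈ Icc α β, Y (ψ u) = y u * ((u ^ 2 - b) / u ^ 2) := fun u hu => by
    rw [hYu, hPψ u hu, hyu, Real.sqrt_mul (hR0 u hu).le, Real.sqrt_sq (hc0 u hu).le]
  -- the two positive branches: nonvanishing, continuity, derivatives
  have hyne : ∀ u, 0 < R u → y u ≠ 0 := fun u h0 => by
    rw [hyu]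
    exact (Real.sqrt_pos.2 h0).ne'
  have hYne : ∀ U, 0 < P U → Y U ≠ 0 := fun U h0 => by
    rw [hYu]
    exact (Real.sqrt_pos.2 h0).ne'
  have hRc : Continuous R := by rw [hRdef]; fun_prop
  have hPc : Continuous P := by rw [hPdef]; fun_prop
  have hP'c : Continuous P' := by rw [hP'def]; fun_prop
  have hyc : Continuous y := by rw [hyf]; exact hRc.sqrt
  have hYc : Continuous Y := by rw [hYf]; exact hPc.sqrt
  have hPd : ∀ x, HasDerivAt P (P' x) x := by
    intro x
    rw [hP'u, hPdef]
    refine ((hasDerivAt_id' x).fun_mul ((((hasDerivAt_id' x).fun_pow 2).fun_sub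
      ((hasDerivAt_id' x).const_mul (2 * a))).add_const (a ^ 2 - 4 * b))).congr_deriv ?_
    norm_num
    ring
  have hYd : ∀ U, 0 < P U → HasDerivAt Y (P' U / (2 * √(P U))) U := by
    intro U h0
    rw [hYf]
    exact (hPd U).sqrt h0.ne'
  -- `ψ` and `ψ′` on the source arc
  have hψc : ContinuousOn ψ (Icc α β) := by
    rw [hψ]
    exact (continuousOn_id.add continuousOn_const).add (continuousOn_const.div continuousOn_id hu0)
  have hψ'c : ContinuousOn (fun u => (u ^ 2 - b) / u ^ 2) (Icc α β) :=
    ((continuousOn_id.pow 2).sub continuousOn_const).div (continuousOn_id.pow 2)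
      fun u hu => pow_ne_zero 2 (hu0 u hu)
  have hψd : ∀ u ∈ Ioo α β, HasDerivAt ψ ((u ^ 2 - b) / u ^ 2) u := by
    intro u hu
    have h0 : u ≠ 0 := hu0 u (Ioo_subset_Icc_self hu)
    rw [hψ]
    refine (((hasDerivAt_id' u).add_const a).fun_add
      ((hasDerivAt_const u b).fun_div (hasDerivAt_id' u) h0)).congr_deriv ?_
    field_simp
    ring
  -- `ψ` is strictly increasing on `[α, β]`
  have hsm : StrictMonoOn ψ (Icc α β) := by
    refine strictMonoOn_of_deriv_pos (convex_Icc α β) hψc fun u hu => ?_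
    rw [interior_Icc] at hu
    rw [(hψd u hu).deriv]
    exact hc0 u (Ioo_subset_Icc_self hu)
  have hγδ : ψ α < ψ β := hsm (left_mem_Icc.2 hαβ.le) (right_mem_Icc.2 hαβ.le) hαβ
  have hφI : ∀ u ∈ Ioo α β, ψ u ∈ Ioo (ψ α) (ψ β) := fun u hu =>
    ⟨hsm (left_mem_Icc.2 hαβ.le) (Ioo_subset_Icc_self hu) hu.1,
      hsm (Ioo_subset_Icc_self hu) (right_mem_Icc.2 hαβ.le) hu.2⟩
  -- `P > 0` on the image interval `[ψ α, ψ β] = ψ '' [α, β]`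
  have hP0' : ∀ V ∈ Icc (ψ α) (ψ β), 0 < P V := by
    intro V hV
    obtain ⟨u, hu, huV⟩ := intermediate_value_Icc hαβ.le hψc hV
    rw [← huV, hPψ u hu]
    exact mul_pos (hR0 u hu) (pow_pos (hc0 u hu) 2)
  -- algebraicity of the new endpoints `ψ α`, `ψ β`
  have hψalg : ∀ u, IsAlgebraic ℚ u → IsAlgebraic ℚ (ψ u) := fun u hu => by
    rw [hψu, div_eq_mul_inv]
    exact (hu.add ha).add (hb.mul hu.inv)
  have hγalg : IsAlgebraic ℚ (ψ α) := hψalg α hα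
  have hδalg : IsAlgebraic ℚ (ψ β) := hψalg β hβ
  -- `ℚ`-semialgebraicity of the data on the two closed slabs
  have hS₁ : IsSemialgebraic ℚ {z : Fin 1 → ℝ | z 0 ∈ Set.Icc α β} :=
    isoTwo_isSemialgebraic_slab hα hβ
  have hS₂ : IsSemialgebraic ℚ {z : Fin 1 → ℝ | z 0 ∈ Set.Icc (ψ α) (ψ β)} :=
    isoTwo_isSemialgebraic_slab hγalg hδalg
  have sR : IsSemialgebraicFunOn ℚ {z : Fin 1 → ℝ | z 0 ∈ Set.Icc α β} (fun z => R (z 0)) :=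
    ((isSemialgebraicFunOn_apply hS₁ 0).fun_mul
      ((((isSemialgebraicFunOn_apply hS₁ 0).fun_pow 2).fun_add
        ((isSemialgebraicFunOn_const_of_isAlgebraic hS₁ ha).fun_mul
          (isSemialgebraicFunOn_apply hS₁ 0))).fun_add
        (isSemialgebraicFunOn_const_of_isAlgebraic hS₁ hb))).congr fun z _ => (hRu (z 0)).symm
  have sQ : IsSemialgebraicFunOn ℚ {z : Fin 1 → ℝ | z 0 ∈ Set.Icc (ψ α) (ψ β)}
      (fun z => z 0 ^ 2 - 2 * a * z 0 + (a ^ 2 - 4 * b)) :=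
    (((isSemialgebraicFunOn_apply hS₂ 0).fun_pow 2).fun_sub
      (((isSemialgebraicFunOn_const_ofNat hS₂ 2).fun_mul
        (isSemialgebraicFunOn_const_of_isAlgebraic hS₂ ha)).fun_mul
        (isSemialgebraicFunOn_apply hS₂ 0))).fun_add
      (((isSemialgebraicFunOn_const_of_isAlgebraic hS₂ ha).fun_pow 2).fun_sub
        ((isSemialgebraicFunOn_const_ofNat hS₂ 4).fun_mul
          (isSemialgebraicFunOn_const_of_isAlgebraic hS₂ hb)))
  have sP : IsSemialgebraicFunOn ℚ {z : Fin 1 → ℝ | z 0 ∈ Set.Icc (ψ α) (ψ β)} (fun z => P (z 0)) :=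
    ((isSemialgebraicFunOn_apply hS₂ 0).fun_mul sQ).congr fun z _ => (hPu (z 0)).symm
  have sP' : IsSemialgebraicFunOn ℚ {z : Fin 1 → ℝ | z 0 ∈ Set.Icc (ψ α) (ψ β)}
      (fun z => P' (z 0)) :=
    ((((isSemialgebraicFunOn_const_ofNat hS₂ 3).fun_mul
      ((isSemialgebraicFunOn_apply hS₂ 0).fun_pow 2)).fun_sub
      (((isSemialgebraicFunOn_const_ofNat hS₂ 4).fun_mul
        (isSemialgebraicFunOn_const_of_isAlgebraic hS₂ ha)).fun_mul
        (isSemialgebraicFunOn_apply hS₂ 0))).fun_add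
      (((isSemialgebraicFunOn_const_of_isAlgebraic hS₂ ha).fun_pow 2).fun_sub
        ((isSemialgebraicFunOn_const_ofNat hS₂ 4).fun_mul
          (isSemialgebraicFunOn_const_of_isAlgebraic hS₂ hb)))).congr
      fun z _ => (hP'u (z 0)).symm
  have sy : IsSemialgebraicFunOn ℚ {z : Fin 1 → ℝ | z 0 ∈ Set.Icc α β} (fun z => y (z 0)) :=
    sR.fun_sqrt.congr fun z _ => (hyu (z 0)).symm
  have sY : IsSemialgebraicFunOn ℚ {z : Fin 1 → ℝ | z 0 ∈ Set.Icc (ψ α) (ψ β)}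
      (fun z => Y (z 0)) :=
    sP.fun_sqrt.congr fun z _ => (hYu (z 0)).symm
  have sψ : IsSemialgebraicFunOn ℚ {z : Fin 1 → ℝ | z 0 ∈ Set.Icc α β} (fun z => ψ (z 0)) :=
    (((isSemialgebraicFunOn_apply hS₁ 0).fun_add
      (isSemialgebraicFunOn_const_of_isAlgebraic hS₁ ha)).fun_add
      ((isSemialgebraicFunOn_const_of_isAlgebraic hS₁ hb).div (isSemialgebraicFunOn_apply hS₁ 0)
        fun z hz => hu0 (z 0) hz)).congr fun z _ => (hψu (z 0)).symm
  have sψ' : IsSemialgebraicFunOn ℚ {z : Fin 1 → ℝ | z 0 ∈ Set.Icc α β}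
      (fun z => (z 0 ^ 2 - b) / z 0 ^ 2) :=
    (((isSemialgebraicFunOn_apply hS₁ 0).fun_pow 2).fun_sub
      (isSemialgebraicFunOn_const_of_isAlgebraic hS₁ hb)).div
      ((isSemialgebraicFunOn_apply hS₁ 0).fun_pow 2) fun z hz => pow_ne_zero 2 (hu0 (z 0) hz)
  have sk₁ : IsSemialgebraicFunOn ℚ {z : Fin 1 → ℝ | z 0 ∈ Set.Icc α β} (fun z => (y (z 0))⁻¹) :=
    sy.fun_inv
  have sk₂ : IsSemialgebraicFunOn ℚ {z : Fin 1 → ℝ | z 0 ∈ Set.Icc (ψ α) (ψ β)}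
      (fun z => (Y (z 0))⁻¹) :=
    sY.fun_inv
  have sk₂' : IsSemialgebraicFunOn ℚ {z : Fin 1 → ℝ | z 0 ∈ Set.Icc (ψ α) (ψ β)}
      (fun z => -(P' (z 0) / (2 * √(P (z 0)))) / Y (z 0) ^ 2) :=
    (sP'.div ((isSemialgebraicFunOn_const_ofNat hS₂ 2).fun_mul sP.fun_sqrt)
      fun z hz => mul_ne_zero two_ne_zero (Real.sqrt_pos.2 (hP0' _ hz)).ne').fun_neg.div
      (sY.fun_pow 2) fun z hz => pow_ne_zero 2 (hYne _ (hP0' _ hz))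
  -- continuity of the data on the closed intervals
  have hk₁c : ContinuousOn (fun v => (y v)⁻¹) (Icc α β) :=
    hyc.continuousOn.inv₀ fun v hv => hyne v (hR0 v hv)
  have hk₂c : ContinuousOn (fun V => (Y V)⁻¹) (Icc (ψ α) (ψ β)) :=
    hYc.continuousOn.inv₀ fun V hV => hYne V (hP0' V hV)
  have hk₂'c : ContinuousOn (fun V => -(P' V / (2 * √(P V))) / Y V ^ 2) (Icc (ψ α) (ψ β)) := by
    refine ((hP'c.continuousOn.div (continuousOn_const.mul hPc.continuousOn.sqrt) ?_).neg).div
      (hYc.continuousOn.pow 2) ?_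
    · exact fun V hV => mul_ne_zero two_ne_zero (Real.sqrt_pos.2 (hP0' V hV)).ne'
    · exact fun V hV => pow_ne_zero 2 (hYne V (hP0' V hV))
  -- the derivative of `k₂ = 1/Y` inside the image interval
  have hk₂d : ∀ V ∈ Ioo (ψ α) (ψ β),
      HasDerivAt (fun V => (Y V)⁻¹) (-(P' V / (2 * √(P V))) / Y V ^ 2) V := fun V hV => by
    have h0 : 0 < P V := hP0' V (Ioo_subset_Icc_self hV)
    exact (hYd V h0).fun_inv (hYne V h0)
  -- the rule-(2) relation `1/y = (1/Y ∘ ψ)·ψ′` inside the arc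
  have hrel : ∀ u ∈ Ioo α β, (y u)⁻¹ = (Y (ψ u))⁻¹ * ((u ^ 2 - b) / u ^ 2) := by
    intro u hu
    have hu' : u ∈ Icc α β := Ioo_subset_Icc_self hu
    rw [hYψ u hu', mul_inv, inv_mul_cancel_right₀ (hc0 u hu').ne']
  -- rule (2) between the two intervals
  have hT := stub_intervalTransport α β (ψ α) (ψ β) hαβ hγδ hα hβ hγalg hδalg
    (fun v => (y v)⁻¹) (fun V => (Y V)⁻¹) (fun V => -(P' V / (2 * √(P V))) / Y V ^ 2)
    ψ (fun u => (u ^ 2 - b) / u ^ 2) sk₁ sk₂ sk₂' sψ sψ' hk₁c hk₂c hk₂'c hψc hψ'c hk₂d hψd rfl rfl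
    hφI hrel
  refine fibStokesDecomposable_congr_off_null 1 _ _ ∅
    Literature.ModelTheory.ExponentialFields.isSemialgebraic_empty measure_empty ?_ hT
  intro x _ _
  rw [div_eq_mul_inv, div_eq_mul_inv]

end Summit.KontsevichZagierPeriods.KontsevichZagierPeriods.Cruxes.StokesGeneration.FibrewiseStokes

end
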